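import Mathlib

/-!
# SoloBlind kernel #213 — exact weighted mass of a pair mode

R.1 of LEMMA R bounds the band-edge pair contribution to a column by the exact Laplace integral of an
exponential: for an eigenvalue `λ` with `Re λ + γ' < 0` (decay beating the Schur weight `e^{γ' B}`,
`γ' = γ ε`) and amplitude `c`,
`∫_{B>0} ‖c e^{λ B}‖ e^{γ' B} dB = ‖c‖ / (-(Re λ) - γ')`.
-/

namespace Summit.AnomalousDissipation.AnomalousDissipation.Theorems

open MeasureTheory Set

/-- Pointwise: `‖c e^{λB}‖ e^{γ'B} = ‖c‖ e^{(Re λ + γ')B}`. -/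
theorem pair_mode_integrand (c lam : ℂ) (γ' B : ℝ) :
    ‖c * Complex.exp (lam * B)‖ * Real.exp (γ' * B) = ‖c‖ * Real.exp ((lam.re + γ') * B) := by
  rw [norm_mul, Complex.norm_exp, mul_assoc, ← Real.exp_add]
  congr 2
  simp [Complex.mul_re, add_mul]

/-- **Exact pair-mode mass.** For `Re λ + γ' < 0`,
`∫_{B>0} ‖c e^{λ B}‖ e^{γ' B} dB = ‖c‖ / (-(Re λ) - γ')`. -/
theorem pair_mode_mass (c lam : ℂ) (γ' : ℝ) (h : lam.re + γ' < 0) :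
    ∫ B in Ioi (0 : ℝ), ‖c * Complex.exp (lam * B)‖ * Real.exp (γ' * B) =
      ‖c‖ / (-lam.re - γ') := by
  simp_rw [pair_mode_integrand]
  rw [integral_const_mul, integral_exp_mul_Ioi h 0]
  simp only [mul_zero, Real.exp_zero]
  have hne : lam.re + γ' ≠ 0 := h.ne
  have hne' : -lam.re - γ' ≠ 0 := by
    intro h0; apply hne; linarith
  field_simp
  ring

/-- Monotone form used in the assembly: if `‖c‖ ≤ C` and the decay margin is at least `μ > 0`
(`Re λ + γ' ≤ -μ`), the pair-mode mass is at most `C / μ`. -/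
theorem pair_mode_mass_le (c lam : ℂ) (γ' C μ : ℝ) (hμ : 0 < μ) (hdec : lam.re + γ' ≤ -μ)
    (hc : ‖c‖ ≤ C) :
    ∫ B in Ioi (0 : ℝ), ‖c * Complex.exp (lam * B)‖ * Real.exp (γ' * B) ≤ C / μ := by
  rw [pair_mode_mass c lam γ' (by linarith)]
  have hden : μ ≤ -lam.re - γ' := by linarith
  calc ‖c‖ / (-lam.re - γ') ≤ ‖c‖ / μ := by
        apply div_le_div_of_nonneg_left (norm_nonneg c) hμ hden
    _ ≤ C / μ := by gcongr

end Summit.AnomalousDissipation.AnomalousDissipation.Theorems
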